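import Literature.Probability.RandomPlanarGeometry.SAWMassCriticalLimit
import Mathlib.Analysis.SpecialFunctions.Pow.Real
import Mathlib.Analysis.Convex.SpecificFunctions.Basic
import Mathlib.Algebra.Order.Field.GeomSum
import Mathlib.Analysis.PSeries
import HarnessLib

/-!
# Span decay of the critical bridge generating functions ⇒ a stretched Hammersley–Welsh exponent
# on `ℤ^d`: the engine `a(z_c;A) ≤ C A^{-η}` ⇒ `c_N ≤ A' exp(K N^{(1−η)/(2−η)}) μ^N` for all `N`

Topic `Literature/Probability/RandomPlanarGeometry` (continues `SAWBridgeSpanGF.lean` / `SAWMassCriticalLimit.lean`: the truncated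
span-`A` bridge generating functions `brGF d M z A = V_M(z;A) = Σ_{m ≤ M} #{m-step bridges of span A} z^m`
of Hutchcroft's `a(z;A)`, Lemma 2.3 `V_M(z_c;A) ≤ 1`, and `count_le_of_brGF_le`). Sources:
T. Hutchcroft, *The Hammersley–Welsh bound for self-avoiding walk revisited*, Electron. Commun.
Probab. 23 (2018), paper no. 5 (arXiv:1708.09460), §2: Proposition 2.1 ("`χ(z) ≤ z^{-1} exp[2B(z) − 2]`",
tree `sum_count_le_exp`), eq. (2.6) ("the trivial inequality `z^n c_n ≤ χ(z)`"), Lemma 2.3 ("`ξ(z_c) ≥ 0`",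
i.e. `a(z_c;n) ≤ 1`, tree `brGF_critical_le_one`) and the proof of Theorem 1.4 (first display:
"`B((1−ε)z_c) = Σ_n a((1−ε)z_c; n) ≤ …`", where a bridge `0 → L_n` has length at least `n`, so that
`a((1−ε)z_c; n) ≤ (1−ε)^n a(z_c; n)`); J. M. Hammersley, D. J. A. Welsh, *Further results on the rate
of convergence to the connective constant of the hypercubical lattice*, Quart. J. Math. Oxford (2) 13
(1962) 108–110 (`c_n ≤ exp(κ√n) μ^n`); N. Madras, G. Slade, *The Self-Avoiding Walk* (1993), §3.1,
(3.1.13)–(3.1.14).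

WHAT THIS FILE DOES. Hutchcroft's Lemma 2.3 (`a(z_c;A) ≤ 1` for every span `A`; in the tree for every
`d`) is exactly what yields Hammersley–Welsh's `exp(O(√N))`: at `z = (1−t)z_c` one gets
`B(z) ≤ Σ_A (1−t)^A ≤ 1/t`, then `c_N ≤ exp(2/t) μ^{N+1} (1−t)^{-N-1}` and `t = N^{-1/2}`. Any DECAY of
the critical span generating functions improves the exponent by the same bookkeeping. We type the
polynomial-decay hypothesis `BridgeSpanDecayRate d C η` (`V_M(z_c;A) ≤ C A^{-η}` for all `A ≥ 1`, all
truncations `M`) and prove THE ENGINE: for `0 < η < 1` it gives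
`c_N ≤ (e μ) · exp((1 + 4C(2^{1−η}/(1−η)+1)) N^{(1−η)/(2−η)}) · μ^N` for ALL `N ≥ 1` — the `ℤ^d` twin
of the honeycomb engine `hexHWStretched_of_bridgeDecay` (`HexSAWHammersleyWelshExplicit.lean`), whose
input `B_T(x_c) → 0` with a rate is a theorem on `ℍ` (Krachun–Panagiotis). On `ℤ^d` (`d = 2, 3, 4`)
the hypothesis is OPEN for every `η > 0` — the qualitative statement `BridgeSpanDecay d`
(`a(z_c;A) → 0`) is already open; Duminil-Copin–Ganguly–Hammond–Manolescu reach `exp(n^{1/2−ε}) μ^n` on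
`ℤ²` (Theorem 1.2: every `ε < 1/466`, infinitely many `n`, inexplicit threshold) without it. So this
file is an implication with an open antecedent, honestly marked — CONDITIONAL: no `η > 0` is certified on
`ℤ^d`, `d ≤ 4`; no named fact is introduced, `BridgeSpanDecayRate` is a hypothesis schema. We also
record that the schema is EMPTY for `η > 1` (`not_bridgeSpanDecayRate_of_one_lt`: it would make
`B(z_c)` finite, against Kesten's divergence `half_log_le_sum_bridgeCount`).

## Contents (namespace `Literature.Probability.RandomPlanarGeometry.SAW.Zd`; all PROVED but the two defs)

* `BridgeSpanDecay d`, `BridgeSpanDecayRate d C η` — hypothesis schemas; `BridgeSpanDecayRate.nonneg`,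
  `BridgeSpanDecayRate.decay` (a rate with `η > 0` gives the qualitative decay);
* `int_le_of_mem_brSpan` — a bridge of span `A` has length `≥ A`;
* `brGF_le_pow_mul_brGF_critical` — `V_M(s z_c; A) ≤ s^A V_M(z_c; A)` for `0 ≤ s ≤ 1`;
* (tree, `SAWMassCriticalLimit.lean`) `bridgeGFpos_le_sum_brGF` — `B⁺_M(z) ≤ Σ_{A=1}^{M} V_M(z;A)`;
* `bridgeGFpos_subcrit_le_of_spanDecayRate` — under the schema, `B⁺_M((1−t)z_c) ≤ C(2^{1−η}/(1−η)+1) t^{η−1}`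
  for `0 < t ≤ 1/2`, every `M`;
* `count_le_exp_of_spanDecayRate` — the finite form before optimising:
  `c_N ≤ exp(2C(2^{1−η}/(1−η)+1) t^{η−1}) μ^{N+1} (1−t)^{-(N+1)}`;
* **`count_le_stretched_of_spanDecayRate_explicit` (THE ENGINE, closed form)** — for all `N ≥ 1`,
  `c_N ≤ (e μ) · exp((1 + 4C(2^{1−η}/(1−η)+1)) · N^{(1−η)/(2−η)}) · μ^N` (constants in the signature, so a
  certified `η` yields numerals at once); `count_le_stretched_of_spanDecayRate` (`∃ A K` form) and
  `count_le_stretched_of_spanDecayRate_two` (the `ℤ^{d+2}` spelling of lane «pcv-sawmu» Sketch_G11 §R56);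
* `not_bridgeSpanDecayRate_of_one_lt` — no `C` works when `η > 1`.

Printed status: the mechanism is Hammersley–Welsh 1962 / Hutchcroft 2018 §2 (and, on `ℍ`,
Duminil-Copin–Smirnov 2012 §3, Krachun–Panagiotis §1); the typed `ℤ^d` engine with `K` explicit in
`(C, η)` and the emptiness remark for `η > 1` are bookkeeping not found in print as statements (lane
«pcv-sawmu» route R56, a-idea-1 ROUTES-G11 §R56 "Z2-BRIDGE-DECAY door").
-/

noncomputable section

open Finset Filter Topology Literature.Probability.LatticeModels Literature.Probability.Percolation
open scoped BigOperators

namespace Literature.Probability.RandomPlanarGeometry.SAW.Zd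

variable {d : ℕ} [NeZero d]

/-! ### §A. The hypothesis schemas -/

/-- **Span decay of the critical bridge generating functions** (qualitative): the truncated span-`A`
bridge generating functions at `z_c = 1/μ` are `≤ ε` for `A ≥ A₀(ε)`, uniformly in the truncation `M`
— "`a(z_c; n) → 0`". Hutchcroft's Lemma 2.3 gives only `a(z_c;n) ≤ 1` (tree `brGF_critical_le_one`);
OPEN on `ℤ^d`, `d ≤ 4` (the honeycomb analogue `B_T(x_c) → 0` is a theorem). A hypothesis schema, not a
fact. [cite: Hutchcroft2018HammersleyWelsh, §2.1 eq. (2.2) and Lemma 2.3 (the object `a(z;n)`, `ξ(z_c) ≥ 0`)] -/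
def BridgeSpanDecay (d : ℕ) [NeZero d] : Prop :=
  ∀ ε : ℝ, 0 < ε → ∃ A₀ : ℕ, ∀ A : ℕ, A₀ ≤ A → ∀ M : ℕ,
    brGF d M (connectiveConstant d)⁻¹ (A : ℤ) ≤ ε

/-- **Span decay with a polynomial RATE**: `V_M(z_c; A) ≤ C A^{-η}` for every span `A ≥ 1` and every
truncation `M` — the hypothesis shape the engine `count_le_stretched_of_spanDecayRate` consumes (the
`ℤ^d` counterpart of a polynomial decay of Duminil-Copin–Smirnov's `B_T(x_c)`). A hypothesis schema,
not a fact; open on `ℤ^d` for every `η > 0`, empty for `η > 1` (`not_bridgeSpanDecayRate_of_one_lt`).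
[cite: Hutchcroft2018HammersleyWelsh, §2.1 eq. (2.2) (the rate `a(z;n) ≤ e^{-ξ(z) n}` shape) and Lemma 2.3] -/
def BridgeSpanDecayRate (d : ℕ) [NeZero d] (C η : ℝ) : Prop :=
  ∀ A : ℕ, 1 ≤ A → ∀ M : ℕ, brGF d M (connectiveConstant d)⁻¹ (A : ℤ) ≤ C * (A : ℝ) ^ (-η)

/-- `V_M(z;A) ≥ 0` for `z ≥ 0`. [cite: Hutchcroft2018HammersleyWelsh, §2.1] -/
theorem brGF_nonneg (M : ℕ) {z : ℝ} (hz : 0 ≤ z) (A : ℤ) : 0 ≤ brGF d M z A :=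
  Finset.sum_nonneg fun n _ => by unfold brSpan; positivity

/-- The one-step bridge `i ↦ (min i 1) e₀` has span `1`: `V_M(z_c;1) ≥ z_c > 0` for `M ≥ 1`, so the
constant of a span-decay rate is positive. [cite: Hutchcroft2018HammersleyWelsh, §2.1] -/
theorem BridgeSpanDecayRate.pos {C η : ℝ} (h : BridgeSpanDecayRate d C η) : 0 < C := by
  classical
  -- the straight one-step walk is a bridge of span 1
  have hμ := connectiveConstant_pos d
  have h1 := h 1 le_rfl 1
  simp only [Nat.cast_one, Real.one_rpow, mul_one] at h1
  -- `V_1(z_c; 1) ≥ #brSpan(1,1) z_c ≥ z_c`, and `#brSpan(1,1) = b_1 ≥ 1`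
  have hcard : (1 : ℝ) ≤ ((brSpan d 1 (1 : ℕ)).card : ℝ) := by
    -- every 1-step bridge has span exactly 1
    have hsub : bridges d 1 ⊆ brSpan d 1 ((1 : ℕ) : ℤ) := by
      intro ω hω
      refine mem_brSpan.2 ⟨hω, ?_⟩
      obtain ⟨hωs, hbr⟩ := mem_bridges.1 hω
      obtain ⟨h00, -, hadj, -⟩ := mem_saws.1 hωs
      have hlow : 0 < ω 1 0 := by
        have := (hbr 1 le_rfl le_rfl).1
        rwa [h00] at this
      have hup : ω 1 0 ≤ 1 := by
        have := abs_apply_le_of_adj h00 hadj 1 le_rfl 0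
        push_cast at this
        exact (le_abs_self _).trans this
      push_cast; omega
    have := Finset.card_le_card hsub
    have h1b := one_le_bridgeCount (d := d) 1
    have : 1 ≤ (brSpan d 1 ((1 : ℕ) : ℤ)).card := h1b.trans this
    exact_mod_cast this
  have hV : (connectiveConstant d)⁻¹ ≤ brGF d 1 (connectiveConstant d)⁻¹ ((1 : ℕ) : ℤ) := by
    unfold brGF
    rw [Finset.sum_range_succ]
    have h0 : 0 ≤ ∑ n ∈ Finset.range 1, ((brSpan d n ((1 : ℕ) : ℤ)).card : ℝ) *
        (connectiveConstant d)⁻¹ ^ n := Finset.sum_nonneg fun n _ => by positivity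
    have : (connectiveConstant d)⁻¹ ≤ ((brSpan d 1 ((1 : ℕ) : ℤ)).card : ℝ) *
        (connectiveConstant d)⁻¹ ^ 1 := by
      rw [pow_one]
      exact le_mul_of_one_le_left (inv_nonneg.2 hμ.le) hcard
    linarith
  have : (0 : ℝ) < (connectiveConstant d)⁻¹ := inv_pos.2 hμ
  push_cast at hV
  linarith

/-- A span-decay rate with `η > 0` gives the qualitative span decay (`C A^{-η} ≤ ε` for `A` large).
[cite: Hutchcroft2018HammersleyWelsh, §2.1 eq. (2.2)] -/
theorem BridgeSpanDecayRate.decay {C η : ℝ} (h : BridgeSpanDecayRate d C η) (hη : 0 < η) :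
    BridgeSpanDecay d := by
  intro ε hε
  have hC := h.pos
  -- choose `A₀ ≥ 1` with `C A₀^{-η} ≤ ε`, i.e. `A₀ ≥ (C/ε)^{1/η}`
  obtain ⟨A₀, hA₀⟩ := exists_nat_ge (max 1 ((C / ε) ^ (1 / η)))
  refine ⟨A₀, fun A hA M => ?_⟩
  have hA1 : (1 : ℝ) ≤ A := by
    have : (A₀ : ℝ) ≤ A := by exact_mod_cast hA
    exact ((le_max_left _ _).trans hA₀).trans this
  have hA1' : 1 ≤ A := by exact_mod_cast hA1
  have hApos : (0 : ℝ) < A := by linarith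
  refine (h A hA1' M).trans ?_
  -- `C A^{-η} ≤ ε ⇔ A^{-η} ≤ ε/C ⇐ A ≥ (C/ε)^{1/η}`
  have hAge : (C / ε) ^ (1 / η) ≤ (A : ℝ) :=
    ((le_max_right _ _).trans hA₀).trans (by exact_mod_cast hA)
  have hq : 0 < C / ε := div_pos hC hε
  have h1 : (A : ℝ) ^ (-η) ≤ ((C / ε) ^ (1 / η)) ^ (-η) :=
    Real.rpow_le_rpow_of_nonpos (Real.rpow_pos_of_pos hq _) hAge (by linarith)
  have h2 : ((C / ε) ^ (1 / η)) ^ (-η) = ε / C := by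
    rw [← Real.rpow_mul hq.le, show (1 / η * -η) = -1 by field_simp, Real.rpow_neg_one, inv_div]
  calc C * (A : ℝ) ^ (-η) ≤ C * (ε / C) := by
        rw [← h2]; exact mul_le_mul_of_nonneg_left h1 hC.le
    _ = ε := by field_simp

/-! ### §B. Bridges of span `A` have length `≥ A`: `V_M(s z_c; A) ≤ s^A V_M(z_c; A)` -/

/-- A bridge from `0` with endpoint level `A` has at least `A` steps (`|ω_n(0)| ≤ n`): "a bridge
`0 → L_n` has length at least `n`". [cite: Hutchcroft2018HammersleyWelsh, proof of Theorem 1.4; MadrasSlade1993, Definition 1.2.4] -/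
theorem int_le_of_mem_brSpan {n : ℕ} {A : ℤ} {ω : ℕ → Site d} (h : ω ∈ brSpan d n A) :
    A ≤ (n : ℤ) := by
  obtain ⟨hω, hA⟩ := mem_brSpan.1 h
  obtain ⟨h00, -, hadj, -⟩ := mem_saws.1 (mem_bridges.1 hω).1
  have := abs_apply_le_of_adj h00 hadj n le_rfl 0
  rw [hA] at this
  exact (le_abs_self A).trans this

/-- **`V_M(s·z; A) ≤ s^A · V_M(z; A)`** for `0 ≤ s ≤ 1`, `z ≥ 0` and a span `A ≥ 0`: each span-`A`
bridge has length `m ≥ A`, so its weight `(sz)^m ≤ s^A z^m` ("`a((1−ε)z_c;n) ≤ (1−ε)^n a(z_c;n)`";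
on `ℍ`: Duminil-Copin–Smirnov's "`B_T^x ≤ (x/x_c)^T B_T^{x_c}`").
[cite: Hutchcroft2018HammersleyWelsh, proof of Theorem 1.4 (first display)] -/
theorem brGF_smul_le_pow_mul (M : ℕ) {s z : ℝ} (hs0 : 0 ≤ s) (hs1 : s ≤ 1) (hz : 0 ≤ z) (A : ℕ) :
    brGF d M (s * z) (A : ℤ) ≤ s ^ A * brGF d M z (A : ℤ) := by
  classical
  unfold brGF
  rw [Finset.mul_sum]
  refine Finset.sum_le_sum fun n _ => ?_
  by_cases hne : (brSpan d n (A : ℤ)).Nonempty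
  · obtain ⟨ω, hω⟩ := hne
    have hAn : A ≤ n := by exact_mod_cast int_le_of_mem_brSpan hω
    calc ((brSpan d n (A : ℤ)).card : ℝ) * (s * z) ^ n
        = s ^ n * (((brSpan d n (A : ℤ)).card : ℝ) * z ^ n) := by rw [mul_pow]; ring
      _ ≤ s ^ A * (((brSpan d n (A : ℤ)).card : ℝ) * z ^ n) :=
          mul_le_mul_of_nonneg_right (pow_le_pow_of_le_one hs0 hs1 hAn) (by positivity)
  · rw [Finset.not_nonempty_iff_eq_empty.1 hne]
    simp

/-! ### §C. `B⁺_M(z) ≤ Σ_{A=1}^{M} V_M(z;A)` is the tree's `bridgeGFpos_le_sum_brGF`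
(`SAWMassCriticalLimit.lean`): a bridge of length `m ∈ [1, M]` has span in `[1, M]`. -/

/-! ### §D. Two elementary sums -/

/-- `Σ_{T=1}^{M} T^{-η} ≤ M^{1−η}/(1−η)` for `0 < η < 1` (induction; the step is Bernoulli's inequality
`(1 + 1/M)^η ≤ 1 + η/M`). [folklore] -/
private theorem sum_rpow_neg_le {η : ℝ} (hη0 : 0 < η) (hη1 : η < 1) (M : ℕ) :
    ∑ T ∈ range M, ((T : ℝ) + 1) ^ (-η) ≤ ((M : ℝ)) ^ (1 - η) / (1 - η) := by
  -- adapted verbatim from `HexSAWHammersleyWelshExplicit.lean` (private there; lane pcv-sawmu a-p5)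
  have h1η : 0 < 1 - η := by linarith
  induction M with
  | zero => simp [Real.zero_rpow h1η.ne']
  | succ M ih =>
    rw [sum_range_succ]
    push_cast
    have hM0 : (0 : ℝ) ≤ M := Nat.cast_nonneg M
    have hM1 : (0 : ℝ) < (M : ℝ) + 1 := by positivity
    have key : (M : ℝ) ^ (1 - η) + (1 - η) * ((M : ℝ) + 1) ^ (-η) ≤ ((M : ℝ) + 1) ^ (1 - η) := by
      rcases Nat.eq_zero_or_pos M with hM | hM
      · subst hM
        simp only [CharP.cast_eq_zero, Real.zero_rpow h1η.ne', zero_add, Real.one_rpow, mul_one]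
        linarith
      · have hMpos : (0 : ℝ) < M := by exact_mod_cast hM
        have hB := rpow_one_add_le_one_add_mul_self (s := (M : ℝ)⁻¹)
          (by linarith [inv_pos.2 hMpos]) hη0.le hη1.le
        have hsplit : ((M : ℝ) + 1) = M * (1 + (M : ℝ)⁻¹) := by field_simp
        have e1 : ((M : ℝ) + 1) ^ (1 - η) = ((M : ℝ) + 1) * ((M : ℝ) + 1) ^ (-η) := by
          rw [sub_eq_add_neg, Real.rpow_add hM1, Real.rpow_one]
        have e2 : (M : ℝ) ^ (1 - η) = (M : ℝ) * (M : ℝ) ^ (-η) := by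
          rw [sub_eq_add_neg, Real.rpow_add hMpos, Real.rpow_one]
        have e3 : (M : ℝ) ^ (-η) = ((M : ℝ) + 1) ^ (-η) * (1 + (M : ℝ)⁻¹) ^ η := by
          rw [hsplit, Real.mul_rpow hMpos.le (by positivity), mul_assoc, ← Real.rpow_add (by positivity),
            neg_add_cancel, Real.rpow_zero, mul_one]
        rw [e1, e2, e3]
        have hpos : 0 ≤ ((M : ℝ) + 1) ^ (-η) := Real.rpow_nonneg hM1.le _
        have : (M : ℝ) * (1 + (M : ℝ)⁻¹) ^ η ≤ M + η := by
          calc (M : ℝ) * (1 + (M : ℝ)⁻¹) ^ η ≤ M * (1 + η * (M : ℝ)⁻¹) :=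
                mul_le_mul_of_nonneg_left hB hMpos.le
            _ = M + η := by field_simp
        nlinarith
    calc ∑ T ∈ range M, ((T : ℝ) + 1) ^ (-η) + ((M : ℝ) + 1) ^ (-η)
        ≤ (M : ℝ) ^ (1 - η) / (1 - η) + ((M : ℝ) + 1) ^ (-η) := by linarith
      _ ≤ ((M : ℝ) + 1) ^ (1 - η) / (1 - η) := by
          rw [div_add' _ _ _ h1η.ne', div_le_div_iff_of_pos_right h1η]
          linarith

/-- The Laplace-type sum bound behind the engine: for `0 < t ≤ 1/2`, `0 < η < 1` and every `N`,
`Σ_{A=1}^{N} (1−t)^{A} A^{-η} ≤ (2^{1−η}/(1−η) + 1)·t^{η−1}` (split at `M = ⌈1/t⌉`: the head by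
`sum_rpow_neg_le`, the tail by `M^{-η} Σ_{A ≥ M} (1−t)^{A} ≤ t^η/t`). [folklore] -/
private theorem sum_geom_rpow_le {t η : ℝ} (ht0 : 0 < t) (ht : t ≤ 1 / 2) (hη0 : 0 < η) (hη1 : η < 1)
    (N : ℕ) :
    ∑ T ∈ range N, (1 - t) ^ (T + 1) * ((T : ℝ) + 1) ^ (-η) ≤
      ((2 : ℝ) ^ (1 - η) / (1 - η) + 1) * t ^ (η - 1) := by
  -- adapted from `HexSAWHammersleyWelshExplicit.lean` (private there; weights `(1−t)^{2(T+1)}` there)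
  have h1η : 0 < 1 - η := by linarith
  have h1t : 0 < 1 - t := by linarith
  have h1t1 : 1 - t ≤ 1 := by linarith
  set M := ⌈t⁻¹⌉₊ with hM
  have htinv : 1 ≤ t⁻¹ := (one_le_inv₀ ht0).2 (by linarith)
  have hMge : t⁻¹ ≤ (M : ℝ) := Nat.le_ceil _
  have hM1 : (1 : ℝ) ≤ M := htinv.trans hMge
  have hMpos : (0 : ℝ) < M := by linarith
  have hterm0 : ∀ T : ℕ, 0 ≤ (1 - t) ^ (T + 1) * ((T : ℝ) + 1) ^ (-η) := fun T =>
    mul_nonneg (pow_nonneg h1t.le _) (Real.rpow_nonneg (by positivity) _)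
  -- split the range at `M`
  have hsplit : ∑ T ∈ range N, (1 - t) ^ (T + 1) * ((T : ℝ) + 1) ^ (-η) ≤
      ∑ T ∈ range M, (1 - t) ^ (T + 1) * ((T : ℝ) + 1) ^ (-η) +
        ∑ T ∈ Ico M (M + N), (1 - t) ^ (T + 1) * ((T : ℝ) + 1) ^ (-η) := by
    rw [← sum_union (disjoint_left.2 fun a ha hb => by
      rw [mem_range] at ha; rw [mem_Ico] at hb; omega)]
    refine sum_le_sum_of_subset_of_nonneg (fun T hT => ?_) fun T _ _ => hterm0 T
    rw [mem_union, mem_range, mem_Ico]; rw [mem_range] at hT; omega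
  -- head: `(1−t)^{T+1} ≤ 1`, then `sum_rpow_neg_le`
  have hhead : ∑ T ∈ range M, (1 - t) ^ (T + 1) * ((T : ℝ) + 1) ^ (-η) ≤
      (2 : ℝ) ^ (1 - η) / (1 - η) * t ^ (η - 1) := by
    have hMle : (M : ℝ) ≤ 2 * t⁻¹ := by
      have := (Nat.ceil_lt_add_one (by positivity : (0 : ℝ) ≤ t⁻¹)).le
      rw [← hM] at this
      linarith
    calc ∑ T ∈ range M, (1 - t) ^ (T + 1) * ((T : ℝ) + 1) ^ (-η)
        ≤ ∑ T ∈ range M, ((T : ℝ) + 1) ^ (-η) :=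
          sum_le_sum fun T _ => mul_le_of_le_one_left (Real.rpow_nonneg (by positivity) _)
            (pow_le_one₀ h1t.le h1t1)
      _ ≤ (M : ℝ) ^ (1 - η) / (1 - η) := sum_rpow_neg_le hη0 hη1 M
      _ ≤ (2 * t⁻¹) ^ (1 - η) / (1 - η) := by
          refine div_le_div_of_nonneg_right ?_ h1η.le
          exact Real.rpow_le_rpow hMpos.le hMle h1η.le
      _ = (2 : ℝ) ^ (1 - η) / (1 - η) * t ^ (η - 1) := by
          rw [Real.mul_rpow (by norm_num) (by positivity), Real.inv_rpow ht0.le, ← Real.rpow_neg ht0.le,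
            neg_sub]
          ring
  -- tail: `T ≥ M ⇒ (T+1)^{-η} ≤ M^{-η} ≤ t^{η}` and `Σ_{T ≥ M} (1−t)^{T+1} ≤ 1/t`
  have htail : ∑ T ∈ Ico M (M + N), (1 - t) ^ (T + 1) * ((T : ℝ) + 1) ^ (-η) ≤ t ^ (η - 1) := by
    have hMη : ∀ T ∈ Ico M (M + N), ((T : ℝ) + 1) ^ (-η) ≤ t ^ η := by
      intro T hT
      rw [mem_Ico] at hT
      have hTM : (M : ℝ) ≤ (T : ℝ) + 1 := by exact_mod_cast (by omega : M ≤ T + 1)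
      calc ((T : ℝ) + 1) ^ (-η) ≤ (t⁻¹) ^ (-η) :=
            Real.rpow_le_rpow_of_nonpos (by positivity) (hMge.trans hTM) (by linarith)
        _ = t ^ η := by rw [Real.inv_rpow ht0.le, ← Real.rpow_neg ht0.le, neg_neg]
    have hgeom : ∑ T ∈ Ico M (M + N), (1 - t) ^ (T + 1) ≤ t⁻¹ := by
      have hq1 : (1 - t) < 1 := by linarith
      calc ∑ T ∈ Ico M (M + N), (1 - t) ^ (T + 1)
          ≤ ∑ T ∈ Ico M (M + N), (1 - t) ^ T :=
            sum_le_sum fun T _ => pow_le_pow_of_le_one h1t.le h1t1 (Nat.le_succ T)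
        _ ≤ (1 - t) ^ M / (1 - (1 - t)) := geom_sum_Ico_le_of_lt_one h1t.le hq1
        _ ≤ 1 / (1 - (1 - t)) :=
            div_le_div_of_nonneg_right (pow_le_one₀ h1t.le h1t1) (by linarith)
        _ = t⁻¹ := by rw [sub_sub_cancel, one_div]
    calc ∑ T ∈ Ico M (M + N), (1 - t) ^ (T + 1) * ((T : ℝ) + 1) ^ (-η)
        ≤ ∑ T ∈ Ico M (M + N), (1 - t) ^ (T + 1) * t ^ η :=
          sum_le_sum fun T hT => mul_le_mul_of_nonneg_left (hMη T hT) (pow_nonneg h1t.le _)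
      _ = (∑ T ∈ Ico M (M + N), (1 - t) ^ (T + 1)) * t ^ η := by rw [sum_mul]
      _ ≤ t⁻¹ * t ^ η := mul_le_mul_of_nonneg_right hgeom (Real.rpow_nonneg ht0.le _)
      _ = t ^ (η - 1) := by
          rw [sub_eq_add_neg, Real.rpow_add ht0, Real.rpow_neg_one]; ring
  calc ∑ T ∈ range N, (1 - t) ^ (T + 1) * ((T : ℝ) + 1) ^ (-η)
      ≤ (2 : ℝ) ^ (1 - η) / (1 - η) * t ^ (η - 1) + t ^ (η - 1) := hsplit.trans (add_le_add hhead htail)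
    _ = ((2 : ℝ) ^ (1 - η) / (1 - η) + 1) * t ^ (η - 1) := by ring

/-! ### §E. The engine -/

/-- **`B⁺_M((1−t)z_c) ≤ C·(2^{1−η}/(1−η)+1)·t^{η−1}`** for `0 < t ≤ 1/2` and every truncation `M`,
under the span-decay rate `V_M(z_c;A) ≤ C A^{-η}` (`0 < η < 1`): `B⁺ ≤ Σ_A V(A)`,
`V((1−t)z_c; A) ≤ (1−t)^A V(z_c; A) ≤ C (1−t)^A A^{-η}`, then the Laplace sum
("`B((1−ε)z_c) = Σ_n a((1−ε)z_c;n) ≤ Σ_n e^{…n}`" with a polynomial instead of Hutchcroft's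
exponential span rate). [cite: Hutchcroft2018HammersleyWelsh, proof of Theorem 1.4 (first display)] -/
theorem bridgeGFpos_subcrit_le_of_spanDecayRate {C η : ℝ} (h : BridgeSpanDecayRate d C η)
    (hη0 : 0 < η) (hη1 : η < 1) {t : ℝ} (ht0 : 0 < t) (ht : t ≤ 1 / 2) (M : ℕ) :
    bridgeGFpos d M ((1 - t) * (connectiveConstant d)⁻¹) ≤
      C * ((2 : ℝ) ^ (1 - η) / (1 - η) + 1) * t ^ (η - 1) := by
  have hμ := connectiveConstant_pos d
  have hC := h.pos
  have h1t : 0 ≤ 1 - t := by linarith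
  have h1t1 : 1 - t ≤ 1 := by linarith
  have hz : 0 ≤ (1 - t) * (connectiveConstant d)⁻¹ := mul_nonneg h1t (inv_nonneg.2 hμ.le)
  calc bridgeGFpos d M ((1 - t) * (connectiveConstant d)⁻¹)
      ≤ ∑ a ∈ Finset.range M, brGF d M ((1 - t) * (connectiveConstant d)⁻¹) ((a + 1 : ℕ) : ℤ) :=
        bridgeGFpos_le_sum_brGF M hz
    _ ≤ ∑ a ∈ Finset.range M, (1 - t) ^ (a + 1) * (C * ((a : ℝ) + 1) ^ (-η)) := by
        refine Finset.sum_le_sum fun a _ => ?_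
        calc brGF d M ((1 - t) * (connectiveConstant d)⁻¹) ((a + 1 : ℕ) : ℤ)
            ≤ (1 - t) ^ (a + 1) * brGF d M (connectiveConstant d)⁻¹ ((a + 1 : ℕ) : ℤ) :=
              brGF_smul_le_pow_mul M h1t h1t1 (inv_nonneg.2 hμ.le) (a + 1)
          _ ≤ (1 - t) ^ (a + 1) * (C * ((a : ℝ) + 1) ^ (-η)) := by
              refine mul_le_mul_of_nonneg_left ?_ (pow_nonneg h1t _)
              have := h (a + 1) (by omega) M
              push_cast at this
              exact this
    _ = C * ∑ a ∈ Finset.range M, (1 - t) ^ (a + 1) * ((a : ℝ) + 1) ^ (-η) := by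
        rw [Finset.mul_sum]
        exact Finset.sum_congr rfl fun a _ => by ring
    _ ≤ C * (((2 : ℝ) ^ (1 - η) / (1 - η) + 1) * t ^ (η - 1)) :=
        mul_le_mul_of_nonneg_left (sum_geom_rpow_le ht0 ht hη0 hη1 M) hC.le
    _ = C * ((2 : ℝ) ^ (1 - η) / (1 - η) + 1) * t ^ (η - 1) := by ring

/-- **The finite form before optimising in `t`**: under the span-decay rate (`0 < η < 1`), for every
`0 < t ≤ 1/2` and every `N`,
`c_N ≤ exp(2C(2^{1−η}/(1−η)+1) t^{η−1}) · μ^{N+1} / (1−t)^{N+1}` — Proposition 2.1 (tree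
`sum_count_le_exp`) and the trivial inequality (2.6) at `z = (1−t)z_c` (compare Theorem 1.4:
"`c_n ≤ exp[Ψ(n) − 2] μ_c^{n+1}`" with `[1 − (1−ε)^{ψ(ε)}]^{-1}` in place of our power of `t`).
[cite: Hutchcroft2018HammersleyWelsh, Proposition 2.1, eq. (2.6) and Theorem 1.4] -/
theorem count_le_exp_of_spanDecayRate {C η : ℝ} (h : BridgeSpanDecayRate d C η)
    (hη0 : 0 < η) (hη1 : η < 1) {t : ℝ} (ht0 : 0 < t) (ht : t ≤ 1 / 2) (N : ℕ) :
    (count d N : ℝ) ≤ Real.exp (2 * (C * ((2 : ℝ) ^ (1 - η) / (1 - η) + 1) * t ^ (η - 1))) *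
      (connectiveConstant d ^ (N + 1) / (1 - t) ^ (N + 1)) := by
  have hμ := connectiveConstant_pos d
  have h1t : 0 < 1 - t := by linarith
  set z : ℝ := (1 - t) * (connectiveConstant d)⁻¹ with hzdef
  have hz : 0 < z := mul_pos h1t (inv_pos.2 hμ)
  have h1 := sum_count_le_exp (d := d) N hz.le
  have h2 : bridgeGFpos d (N + 1) z ≤ C * ((2 : ℝ) ^ (1 - η) / (1 - η) + 1) * t ^ (η - 1) :=
    bridgeGFpos_subcrit_le_of_spanDecayRate h hη0 hη1 ht0 ht (N + 1)
  have h3 : (count d N : ℝ) * z ^ (N + 1) ≤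
      ∑ n ∈ Finset.range (N + 1), (count d n : ℝ) * z ^ (n + 1) :=
    Finset.single_le_sum (f := fun n => (count d n : ℝ) * z ^ (n + 1))
      (fun n _ => by positivity) (Finset.mem_range.2 (Nat.lt_succ_self N))
  have h4 : (count d N : ℝ) * z ^ (N + 1) ≤
      Real.exp (2 * (C * ((2 : ℝ) ^ (1 - η) / (1 - η) + 1) * t ^ (η - 1))) :=
    h3.trans (h1.trans (Real.exp_le_exp.2 (by linarith)))
  have hzpow : z ^ (N + 1) = (1 - t) ^ (N + 1) / connectiveConstant d ^ (N + 1) := by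
    rw [hzdef, mul_pow, inv_pow, div_eq_mul_inv]
  rw [hzpow, ← le_div_iff₀ (div_pos (pow_pos h1t _) (pow_pos hμ _))] at h4
  rwa [div_div_eq_mul_div, mul_div_assoc] at h4

/-- **THE ENGINE, CLOSED FORM: a polynomial span decay `V_M(z_c;A) ≤ C A^{-η}` (`0 < η < 1`) of the
critical bridge generating functions gives the STRETCHED Hammersley–Welsh exponent `θ = (1−η)/(2−η) < 1/2`
for ALL `N ≥ 1`**: `c_N ≤ (e·μ)·exp((1 + 4C(2^{1−η}/(1−η)+1)) N^θ)·μ^N`, constants in the signature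
(`t := ½ N^{-1/(2−η)}` in `count_le_exp_of_spanDecayRate`, `(1−t)^{-(N+1)} ≤ e^{2t(N+1)} ≤ e·e^{N^θ}`,
`t^{η−1} ≤ 2N^θ`). The limiting case `η → 0` (`a(z_c;A) ≤ 1`, Lemma 2.3, a tree theorem) is
Hammersley–Welsh's `θ = 1/2`; any `η > 0` on `ℤ²` would be the first all-`N` improvement of the
Hammersley–Welsh exponent there (open). [cite: Hutchcroft2018HammersleyWelsh, Theorem 1.4 and Corollary 1.5 (mechanism); HammersleyWelsh1962, Theorem] -/
theorem count_le_stretched_of_spanDecayRate_explicit {C η : ℝ} (h : BridgeSpanDecayRate d C η)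
    (hη0 : 0 < η) (hη1 : η < 1) (N : ℕ) (hN : 1 ≤ N) :
    (count d N : ℝ) ≤ (Real.exp 1 * connectiveConstant d) *
      Real.exp ((1 + 4 * C * ((2 : ℝ) ^ (1 - η) / (1 - η) + 1)) * (N : ℝ) ^ ((1 - η) / (2 - η))) *
        connectiveConstant d ^ N := by
  set μ := connectiveConstant d with hμdef
  have hμpos : 0 < μ := connectiveConstant_pos d
  have hC := h.pos
  set D : ℝ := (2 : ℝ) ^ (1 - η) / (1 - η) + 1 with hD
  have h1η : 0 < 1 - η := by linarith
  have h2η : 0 < 2 - η := by linarith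
  have hD0 : 0 < D := by positivity
  set θ := (1 - η) / (2 - η) with hθ
  have hNpos : (0 : ℝ) < N := by exact_mod_cast hN
  -- `t := ½ N^{-1/(2-η)}`
  set t := (1 / 2 : ℝ) * (N : ℝ) ^ (-(1 : ℝ) / (2 - η)) with htdef
  have hNr : (N : ℝ) ^ (-(1 : ℝ) / (2 - η)) ≤ 1 :=
    Real.rpow_le_one_of_one_le_of_nonpos (by exact_mod_cast hN) (by
      rw [neg_div]; exact neg_nonpos.2 (div_nonneg zero_le_one h2η.le))
  have hNr0 : 0 < (N : ℝ) ^ (-(1 : ℝ) / (2 - η)) := Real.rpow_pos_of_pos hNpos _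
  have ht0 : 0 < t := by positivity
  have ht : t ≤ 1 / 2 := by rw [htdef]; nlinarith
  have h1t : 0 < 1 - t := by linarith
  have hmain := count_le_exp_of_spanDecayRate h hη0 hη1 ht0 ht N
  -- `N t = ½ N^θ` and `t^{η-1} = 2^{1-η} N^{θ} ≤ 2 N^θ`
  have hexp1 : (1 : ℝ) + -(1 : ℝ) / (2 - η) = θ := by rw [hθ]; field_simp; ring
  have hNN : (N : ℝ) * (N : ℝ) ^ (-(1 : ℝ) / (2 - η)) = (N : ℝ) ^ θ := by
    rw [← hexp1, Real.rpow_add hNpos, Real.rpow_one]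
  have hNt : (N : ℝ) * t = (1 / 2) * (N : ℝ) ^ θ := by
    rw [htdef, ← hNN]; ring
  have htη : t ^ (η - 1) ≤ 2 * (N : ℝ) ^ θ := by
    rw [htdef, Real.mul_rpow (by norm_num) hNr0.le, ← Real.rpow_mul hNpos.le]
    have e : -(1 : ℝ) / (2 - η) * (η - 1) = θ := by rw [hθ]; field_simp; ring
    rw [e]
    have h2 : (1 / 2 : ℝ) ^ (η - 1) ≤ 2 := by
      rw [one_div, Real.inv_rpow (by norm_num), ← Real.rpow_neg (by norm_num), neg_sub]
      calc (2 : ℝ) ^ (1 - η) ≤ (2 : ℝ) ^ (1 : ℝ) :=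
            Real.rpow_le_rpow_of_exponent_le (by norm_num) (by linarith)
        _ = 2 := Real.rpow_one 2
    exact mul_le_mul_of_nonneg_right h2 (Real.rpow_nonneg hNpos.le _)
  have hNθ1 : 1 ≤ (N : ℝ) ^ θ := Real.one_le_rpow (by exact_mod_cast hN) (div_nonneg h1η.le h2η.le)
  have hNθ0 : 0 ≤ (N : ℝ) ^ θ := by linarith
  -- `(1 - t)^{-(N+1)} ≤ exp(2 t (N+1)) ≤ exp 1 · exp(N^θ)`
  have hinv1t : (1 - t)⁻¹ ≤ Real.exp (2 * t) := by
    -- `1/(1-t) ≤ 1 + 2t ≤ exp(2t)` for `t ≤ 1/2`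
    have h1 : (1 - t)⁻¹ ≤ 1 + 2 * t := by
      rw [inv_le_comm₀ h1t (by linarith), ← one_div, div_le_iff₀ (by linarith : (0:ℝ) < 1 + 2 * t)]
      nlinarith
    exact h1.trans (by linarith [Real.add_one_le_exp (2 * t)])
  have hpow : ((1 - t) ^ (N + 1))⁻¹ ≤ Real.exp 1 * Real.exp ((N : ℝ) ^ θ) := by
    calc ((1 - t) ^ (N + 1))⁻¹ = ((1 - t)⁻¹) ^ (N + 1) := by rw [inv_pow]
      _ ≤ (Real.exp (2 * t)) ^ (N + 1) := pow_le_pow_left₀ (inv_nonneg.2 h1t.le) hinv1t _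
      _ = Real.exp (2 * t * (N + 1)) := by rw [← Real.exp_nat_mul]; push_cast; ring_nf
      _ = Real.exp (2 * t) * Real.exp (2 * ((N : ℝ) * t)) := by rw [← Real.exp_add]; ring_nf
      _ ≤ Real.exp 1 * Real.exp ((N : ℝ) ^ θ) := by
          refine mul_le_mul (Real.exp_le_exp.2 (by linarith)) (Real.exp_le_exp.2 ?_)
            (Real.exp_nonneg _) (Real.exp_nonneg _)
          rw [hNt]; linarith
  -- the first exponent is at most `4 C D N^θ`
  have hexpo : 2 * (C * D * t ^ (η - 1)) ≤ 4 * C * D * (N : ℝ) ^ θ := by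
    have := mul_le_mul_of_nonneg_left htη (mul_nonneg hC.le hD0.le)
    nlinarith
  calc (count d N : ℝ)
      ≤ Real.exp (2 * (C * D * t ^ (η - 1))) * (μ ^ (N + 1) / (1 - t) ^ (N + 1)) := hmain
    _ = Real.exp (2 * (C * D * t ^ (η - 1))) * ((1 - t) ^ (N + 1))⁻¹ * (μ * μ ^ N) := by
        rw [pow_succ]; ring
    _ ≤ Real.exp (4 * C * D * (N : ℝ) ^ θ) * (Real.exp 1 * Real.exp ((N : ℝ) ^ θ)) * (μ * μ ^ N) := by
        refine mul_le_mul_of_nonneg_right (mul_le_mul (Real.exp_le_exp.2 hexpo) hpow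
          (inv_nonneg.2 (pow_nonneg h1t.le _)) (Real.exp_nonneg _)) (by positivity)
    _ = Real.exp 1 * μ * Real.exp ((1 + 4 * C * D) * (N : ℝ) ^ θ) * μ ^ N := by
        have : Real.exp (4 * C * D * (N : ℝ) ^ θ) * Real.exp ((N : ℝ) ^ θ) =
            Real.exp ((1 + 4 * C * D) * (N : ℝ) ^ θ) := by rw [← Real.exp_add]; ring_nf
        calc Real.exp (4 * C * D * (N : ℝ) ^ θ) * (Real.exp 1 * Real.exp ((N : ℝ) ^ θ)) * (μ * μ ^ N)
            = Real.exp 1 * μ * (Real.exp (4 * C * D * (N : ℝ) ^ θ) * Real.exp ((N : ℝ) ^ θ)) * μ ^ N := by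
              ring
          _ = _ := by rw [this]

/-- **THE ENGINE (`∃ A K` form)**: a span-decay rate with `0 < η < 1` gives
`∃ A K, ∀ N ≥ 1, c_N ≤ A exp(K N^{(1−η)/(2−η)}) μ^N` (`A = e μ`, `K = 1 + 4C(2^{1−η}/(1−η)+1)` from
`count_le_stretched_of_spanDecayRate_explicit`). Conditional: no `η > 0` is certified on `ℤ^d`,
`d ≤ 4` (the door `BridgeSpanDecay`); unconditionally in print, Duminil-Copin–Ganguly–Hammond–Manolescu's
Theorem 1.2 gives `c_n ≤ exp(n^{1/2−ε}) μ^n` on `ℤ²` for every `ε < 1/466` along infinitely many `n`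
(indeed on windows `[j, j^{4/3}]`), with an inexplicit threshold.
[cite: Hutchcroft2018HammersleyWelsh, Theorem 1.4 and Corollary 1.5 (mechanism); DuminilCopinGangulyHammondManolescu2020, Theorem 1.2 (p. 3, the unconditional planar comparison point)] -/
theorem count_le_stretched_of_spanDecayRate {C η : ℝ} (h : BridgeSpanDecayRate d C η)
    (hη0 : 0 < η) (hη1 : η < 1) :
    ∃ A K : ℝ, ∀ N : ℕ, 1 ≤ N →
      (count d N : ℝ) ≤ A * Real.exp (K * (N : ℝ) ^ ((1 - η) / (2 - η))) * connectiveConstant d ^ N :=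
  ⟨_, _, fun N hN => count_le_stretched_of_spanDecayRate_explicit h hη0 hη1 N hN⟩

/-- The engine in the vocabulary of lane «pcv-sawmu» Sketch_G11 §R56 (`ℤ^{d+2}`, hypothesis written
out): `(∀ A ≥ 1, ∀ M, V_M(z_c;A) ≤ C A^{-η}) ⇒ ∃ A K, ∀ N ≥ 1, c_N ≤ A exp(K N^{(1−η)/(2−η)}) μ^N`.
[cite: Hutchcroft2018HammersleyWelsh, Theorem 1.4 and Corollary 1.5 (mechanism)] -/
theorem count_le_stretched_of_spanDecayRate_two (d : ℕ) {C η : ℝ} (hη0 : 0 < η) (hη1 : η < 1)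
    (h : ∀ A : ℕ, 1 ≤ A → ∀ M : ℕ,
      brGF (d + 2) M (connectiveConstant (d + 2))⁻¹ (A : ℤ) ≤ C * (A : ℝ) ^ (-η)) :
    ∃ A K : ℝ, ∀ N : ℕ, 1 ≤ N →
      (count (d + 2) N : ℝ) ≤
        A * Real.exp (K * (N : ℝ) ^ ((1 - η) / (2 - η))) * connectiveConstant (d + 2) ^ N :=
  count_le_stretched_of_spanDecayRate (d := d + 2) h hη0 hη1

/-! ### §F. The schema is empty for `η > 1` -/

/-- **No span-decay rate with `η > 1` exists**: it would bound `B⁺_M(z_c) ≤ Σ_A V_M(z_c;A) ≤ C ζ(η)`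
uniformly in `M`, against Kesten's divergence `B⁺_{M+1}(z_c) ≥ ½ log((M+1)/μ)` (Madras–Slade (3.1.14),
tree `half_log_le_sum_bridgeCount`). [cite: MadrasSlade1993, Corollary 3.1.8 and eq. (3.1.14); Hutchcroft2018HammersleyWelsh, Lemma 2.3] -/
theorem not_bridgeSpanDecayRate_of_one_lt {C η : ℝ} (hη : 1 < η) : ¬ BridgeSpanDecayRate d C η := by
  intro h
  have hμ := connectiveConstant_pos d
  have hC := h.pos
  -- the `p`-series bound
  have hsum : Summable fun n : ℕ => ((n : ℝ) ^ η)⁻¹ := Real.summable_nat_rpow_inv.2 hη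
  set S : ℝ := ∑' n : ℕ, ((n : ℝ) ^ η)⁻¹ with hS
  -- uniform bound on the critical `B⁺`
  have hB : ∀ M : ℕ, bridgeGFpos d M (connectiveConstant d)⁻¹ ≤ C * S := by
    intro M
    calc bridgeGFpos d M (connectiveConstant d)⁻¹
        ≤ ∑ a ∈ Finset.range M, brGF d M (connectiveConstant d)⁻¹ ((a + 1 : ℕ) : ℤ) :=
          bridgeGFpos_le_sum_brGF M (inv_nonneg.2 hμ.le)
      _ ≤ ∑ a ∈ Finset.range M, C * (((a + 1 : ℕ) : ℝ) ^ η)⁻¹ := by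
          refine Finset.sum_le_sum fun a _ => (h (a + 1) (by omega) M).trans ?_
          rw [Real.rpow_neg (by positivity)]
      _ = C * ∑ a ∈ Finset.range M, (((a + 1 : ℕ) : ℝ) ^ η)⁻¹ := by rw [Finset.mul_sum]
      _ ≤ C * S := by
          refine mul_le_mul_of_nonneg_left ?_ hC.le
          have h1 : ∑ a ∈ Finset.range M, (((a + 1 : ℕ) : ℝ) ^ η)⁻¹ =
              ∑ n ∈ Finset.Ico 1 (M + 1), ((n : ℝ) ^ η)⁻¹ := by
            rw [Finset.range_eq_Ico, Finset.sum_Ico_add' (fun n : ℕ => ((n : ℝ) ^ η)⁻¹) 0 M 1]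
          rw [h1]
          exact hsum.sum_le_tsum _ fun n _ => by positivity
  -- against `½ log((M+1)/μ) ≤ B⁺_{M+1}(z_c)`: pick `M` with `log((M+1)/μ) > 2 C S`
  obtain ⟨M, hM⟩ := exists_nat_gt (connectiveConstant d * Real.exp (2 * C * S + 1))
  have h1 := half_log_le_sum_bridgeCount (d := d) M
  have h2 := hB (M + 1)
  have hpos : 0 < ((M : ℝ) + 1) / connectiveConstant d := by positivity
  have h3 : Real.exp (2 * C * S + 1) < ((M : ℝ) + 1) / connectiveConstant d := by
    rw [lt_div_iff₀ hμ]
    have : (M : ℝ) < M + 1 := by linarith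
    nlinarith [Real.exp_pos (2 * C * S + 1)]
  have h4 : 2 * C * S + 1 < Real.log (((M : ℝ) + 1) / connectiveConstant d) := by
    rw [← Real.log_exp (2 * C * S + 1)]
    exact Real.log_lt_log (Real.exp_pos _) h3
  linarith

end Literature.Probability.RandomPlanarGeometry.SAW.Zd

end
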